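import Summits.HubbardSuperconductivity.HubbardSuperconductivity.Theses.LevyLogBootstrap
import Summits.HubbardSuperconductivity.HubbardSuperconductivity.Theorems.LevyLogBootstrapHalfFilledOrderGroundSector
import Summits.HubbardSuperconductivity.HubbardSuperconductivity.Theorems.AnisotropyChordSectorAnchorXY
import Literature.MathematicalPhysics.QuantumLattice.XYZGroundStateOrderSpinHalfHolds
import Literature.MathematicalPhysics.QuantumLattice.XYZGroundStateOrderHolds

/-!
# Route `LevyLogBootstrap`, hub `HalfFilledOrder` (stmt-HubbardSuperconductivity-0906) — window, part 3:
# half-filled planar order on the Björnberg–Ueltschi window `Δ ∈ [-0.109, 0]`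

`HalfFilledOrder` (shared verbatim by the routes `LevyLogBootstrap`, `AnisotropyChord` and, as
`PbHalfFilledXYOrder`, `PlaquetteBoson`) asks, for EVERY `Δ ∈ (-1, 0]`, for planar order
`Re⟨ψ, S⁺_tot S⁻_tot ψ⟩ ≥ c(Δ)·M⁴` of every normalised `S³_tot = 0` sector ground state `ψ` of
`H_M(Δ) = xxzHamiltonian 1 (torusGraph 2 M) (-1) Δ` on large even tori — an open problem on most of
the interval. This file proves it on the window where it is known in print, in the SECTOR form the
routes consume:

* `halfFilledOrder_window`: for every `Δ ∈ [-0.109, 0]` there are `c > 0`, `M₀` with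
  `c·M⁴ ≤ Re⟨ψ, S⁺_tot S⁻_tot ψ⟩` for every even `M ≥ M₀` and every normalised `S³_tot = 0` sector
  ground state `ψ` of `H_M(Δ)`;
* `halfFilledOrder_of_deepWindow`: consequently `HalfFilledOrder` REDUCES to the same statement on
  the complementary interval `Δ ∈ (-1, -0.109)` (the genuinely open part, towards the Heisenberg
  point).

Proof of the window. (1) Björnberg–Ueltschi's spin-½ planar window, PROVED in the tree
(`bjornbergUeltschi2022_ground_lro_spinHalf_holds`, `J⁽¹⁾ = J⁽³⁾ = 1`, `J⁽²⁾ = Δ ∈ [-0.109, 0]`):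
long-range order `liminf (2k)⁻⁴ Σ_{x,y} Re ω₀(S²_x S²_y) > 0` of the TRACIAL ground state of
`anisotropicTorus 2 M 1 1 Δ 1 = 2·H₃(1, Δ, 1)`, turned into a floor (`bu_axisFloor`). (2) The frame
dictionary of the tree (`xyz₃_groundStateFunctional_frame`, cyclic permutation of the spin axes):
`H_M(Δ) = H₃(1, 1, Δ)` (`xxzTorus_eq_xyzBondHamiltonian₃`) and
`ω_{H₃(1,1,Δ)}(SˣSˣ) = ω_{H₃(1,Δ,1)}(SᶻSᶻ)`, so the floor is a floor for `Re ω₀((Sˣ_tot)²)`, hence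
for `Re ω₀((Sˣ_tot)² + (Sʸ_tot)²)`. (3) Every ground vector of `H_M(Δ)`, `Δ ≤ 0`, is half filled and
the half-filled sector ground state is Perron–Frobenius unique (part 2,
`xxzTorus_groundSpace_eq_span`), so `ω₀ = ⟨ψ, · ψ⟩`
(`groundStateFunctional_eq_of_hasUniqueGroundState`); finally `(Sˣ)² + (Sʸ)² = S⁺S⁻` on the sector
(`AnisotropyChord.raiseOn_mul_lowerOn_mulVec_of_mem_zero`).

Sources: J. E. Björnberg, D. Ueltschi, in *The Physics and Mathematics of Elliott Lieb* I (EMS, 2022)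
77–108 = arXiv:2204.12896, Thm. 3.2 and p. 11; T. Kennedy, E. H. Lieb, B. S. Shastry, PRL 61 (1988)
2582 and J. Stat. Phys. 53 (1988) 1019; K. Kubo, T. Kishi, PRL 61 (1988) 2585;
M. Aizenman, E. H. Lieb, R. Seiringer, J. P. Solovej, J. Yngvason, PRA 70 (2004) 023612, App. A.
No definition is introduced.
-/

-- the mandated namespace `Summit.<Summit>.<Problem>.Theorems` repeats `HubbardSuperconductivity`
set_option linter.dupNamespace false

noncomputable section

namespace Summit.HubbardSuperconductivity.HubbardSuperconductivity.Theorems.LevyLogBootstrap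

open Matrix Finset Filter Complex
open Literature.MathematicalPhysics.QuantumLattice Literature.Probability.LatticeModels
open Summit.HubbardSuperconductivity.HubbardSuperconductivity.Theses.LevyLogBootstrap
open Summit.HubbardSuperconductivity.HubbardSuperconductivity.Theorems.AnisotropyChord
  (raiseOn_mul_lowerOn_mulVec_of_mem_zero lowestEnergyInSector_eq_groundEnergy)
open Summit.HubbardSuperconductivity.HubbardSuperconductivity.Theorems.PolyaSchurPairBoson
  (xxz_sector_perronFrobenius)
open Summit.AtomisticToContinuum.BoseEinsteinCondensation.Theorems.BECStronglyRayleighSectorPerron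
  (torusGraph_connected exists_config_weight_eq)

/-! ### The XXZ torus in Björnberg–Ueltschi's three-coupling frame -/

/-- **`H_M(Δ) = H₃(1, 1, Δ)`**: the tree's XXZ torus is Björnberg–Ueltschi's bond Hamiltonian with
couplings `(1, 1, Δ)`. [folklore] -/
theorem xxzTorus_eq_xyzBondHamiltonian₃ {d : ℕ} (L : ℕ) [NeZero L] (n : ℕ) (Δ : ℝ) :
    xxzHamiltonian n (torusGraph d L) (-1) Δ = xyzBondHamiltonian₃ L n 1 1 Δ := by
  rw [xxzHamiltonian, xyzBondHamiltonian₃, ofReal_neg, ofReal_one, neg_one_smul]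
  congr 1
  refine sum_congr rfl fun e _ => ?_
  induction e using Sym2.ind with
  | h x y => simp only [Sym2.lift_mk, xyzBond₃, ofReal_one, one_smul]

/-- **The frame dictionary**: `Re ω_{H_M(Δ)}(Sˣ_x Sˣ_y)` is Björnberg–Ueltschi's third-axis
ground-state correlation of `anisotropicTorus 2 M 1 1 Δ 1` (cyclic permutation of the spin axes,
`xyz₃_groundStateFunctional_frame`; `ω_{2K} = ω_K`). [cite: BjornbergUeltschi2022, Proposition 2.4] -/
theorem re_groundStateFunctional_xx_eq_axisCorr (M : ℕ) [NeZero M] (Δ : ℝ) (x y : TorusSite 2 M) :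
    ((xxzHamiltonian 1 (torusGraph 2 M) (-1) Δ).groundStateFunctional
        (siteSpin 1 x 0 * siteSpin 1 y 0)).re =
      groundStateAxisCorrTorus (d := 2) M 1 1 Δ 1 x y := by
  rw [groundStateAxisCorrTorus_of_neZero, groundStateFunctional_anisotropicTorus_three,
    xxzTorus_eq_xyzBondHamiltonian₃, (xyz₃_groundStateFunctional_frame M 1 1 1 Δ x y).1]

/-! ### Sums of two-point functions as expectations of squares of total spins -/

/-- `Σ_{x,y} Re ω(S^α_x S^α_y) = Re ω((S^α_tot)²)` for any matrix state `ω = ω_A`. [folklore] -/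
theorem sum_sum_re_groundStateFunctional_siteSpin {Λ : Type*} [Fintype Λ] [DecidableEq Λ] (n : ℕ)
    (A : Op Λ (n + 1)) (α : Fin 3) :
    ∑ x : Λ, ∑ y : Λ, (A.groundStateFunctional (siteSpin n x α * siteSpin n y α)).re =
      (A.groundStateFunctional (totalSpin n α * totalSpin n α)).re := by
  rw [totalSpin, sum_mul_sum, map_sum, re_sum]
  refine sum_congr rfl fun x _ => ?_
  rw [map_sum, re_sum]

/-- `Σ_{x,y} G³_L(x,y) = Re ω₀((S³_tot)²) ≥ 0` for Björnberg–Ueltschi's third-axis correlation.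
[folklore] -/
theorem sum_sum_groundStateAxisCorrTorus_nonneg {d : ℕ} (L : ℕ) [NeZero L] (n : ℕ)
    (J₁ J₂ J₃ : ℝ) :
    0 ≤ ∑ x : TorusSite d L, ∑ y : TorusSite d L, groundStateAxisCorrTorus (d := d) L n J₁ J₂ J₃ x y := by
  simp only [groundStateAxisCorrTorus_of_neZero]
  rw [sum_sum_re_groundStateFunctional_siteSpin]
  exact re_groundStateFunctional_mul_self_nonneg _ (totalSpin_isHermitian n 2)

/-! ### The ground state of the half-filled easy-plane XXZ torus is unique -/

/-- **The ground space of the easy-plane spin-½ XXZ torus is a line in the sector `S³_tot = 0`**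
(`Δ ≤ 0`, even `M ≥ 4`, here `d = 2`): it is spanned by the Perron–Frobenius vector of the
half-filled sector (`xxz_sector_perronFrobenius`), because every ground vector is half filled; in
particular the sector energy of `S³_tot = 0` is the ground energy, and any sector ground vector spans
the ground space. Aizenman–Lieb–Seiringer–Solovej–Yngvason (2004), App. A; Tasaki (2020) §2.4.
[folklore] -/
theorem xxzTorus_groundSpace_eq_span (M : ℕ) [NeZero M] (hM : Even M) (h4 : 4 ≤ M) {Δ : ℝ}
    (hΔ : Δ ≤ 0) :
    ∃ φ : TensorIndex (TorusSite 2 M) 2 → ℂ, φ ≠ 0 ∧ φ ∈ spinZSector (Λ := TorusSite 2 M) 1 0 ∧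
      (xxzHamiltonian 1 (torusGraph 2 M) (-1) Δ).groundSpace = ℂ ∙ φ ∧
      lowestEnergyInSector 1 (xxzHamiltonian 1 (torusGraph 2 M) (-1) Δ) 0 =
        (xxzHamiltonian 1 (torusGraph 2 M) (-1) Δ).groundEnergy := by
  set H : Op (TorusSite 2 M) 2 := xxzHamiltonian 1 (torusGraph 2 M) (-1) Δ with hHdef
  have hH : H.IsHermitian := xxzHamiltonian_isHermitian 1 _ (-1) Δ
  haveI : Nonempty (TensorIndex (TorusSite 2 M) 2) := ⟨fun _ => 0⟩
  -- every ground vector is half filled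
  have hGS : H.groundSpace ≤ spinZSector 1 0 :=
    groundSpace_xxzTorus_le_spinZSector_zero (d := 2) (by norm_num) M hM (by omega) hΔ
  -- the Perron vector of the half-filled sector (weight `M²/2`)
  have hcard : Fintype.card (TorusSite 2 M) = M ^ 2 := by
    show Fintype.card (Fin 2 → ZMod M) = M ^ 2
    rw [Fintype.card_fun, ZMod.card, Fintype.card_fin]
  obtain ⟨σ₁, hσ₁⟩ := exists_config_weight_eq 2 M (M ^ 2 / 2) (Nat.div_le_self _ _)
  obtain ⟨⟨φ, hφK, hφ0, -, hHφ⟩, huniq⟩ :=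
    xxz_sector_perronFrobenius (torusGraph 2 M) (torusGraph_connected 2 M) Δ (M ^ 2 / 2) ⟨σ₁, hσ₁⟩
  have hlabel : ((Fintype.card (TorusSite 2 M) * 1 : ℕ) : ℝ) / 2 - ((M ^ 2 / 2 : ℕ) : ℝ) = 0 := by
    rw [hcard, mul_one]
    obtain ⟨k, rfl⟩ := hM
    have hk : (k + k) ^ 2 / 2 = 2 * k ^ 2 := by
      rw [show (k + k) ^ 2 = 2 * (2 * k ^ 2) by ring, Nat.mul_div_cancel_left _ (by norm_num)]
    rw [hk]
    push_cast
    ring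
  rw [hlabel] at hφK hHφ huniq
  -- the sector energy is the ground energy
  obtain ⟨u, huG, hu0⟩ := (Submodule.ne_bot_iff _).1 (groundSpace_ne_bot_holds hH)
  have hEsec : lowestEnergyInSector 1 H 0 = H.groundEnergy :=
    lowestEnergyInSector_eq_groundEnergy hH hu0 huG (hGS huG)
  refine ⟨φ, hφ0, hφK, le_antisymm ?_ ?_, hEsec⟩
  · intro v hvG
    have hvK : v ∈ spinZSector (Λ := TorusSite 2 M) 1 0 := hGS hvG
    have hHv : H *ᵥ v = ((lowestEnergyInSector 1 H 0 : ℝ) : ℂ) • v := by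
      rw [hEsec]; exact (mem_groundSpace_iff H v).1 hvG
    obtain ⟨c, hc⟩ := huniq φ v hφK hvK hHφ hHv hφ0
    exact Submodule.mem_span_singleton.2 ⟨c, hc.symm⟩
  · rw [Submodule.span_singleton_le_iff_mem, mem_groundSpace_iff, ← hEsec]
    exact hHφ

/-! ### Björnberg–Ueltschi's window, floor form -/

/-- **Björnberg–Ueltschi's spin-½ planar window, floor form**: for `Δ ∈ [-0.109, 0]` there are
`a > 0` and `M₀` with `a·M⁴ ≤ Σ_{x,y} G³_M(x,y)` (third-axis ground-state correlation of
`anisotropicTorus 2 M 1 1 Δ 1`) for every even `M ≥ M₀` — a positive `liminf`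
(`bjornbergUeltschi2022_ground_lro_spinHalf_holds`) of a nonnegative sequence is eventually
undercut by any smaller positive number. [cite: BjornbergUeltschi2022, Theorem 3.2 and p. 11] -/
theorem bu_axisFloor {Δ : ℝ} (hΔ1 : -0.109 ≤ Δ) (hΔ0 : Δ ≤ 0) :
    ∃ a : ℝ, 0 < a ∧ ∃ M₀ : ℕ, ∀ (M : ℕ) [NeZero M], Even M → M₀ ≤ M →
      a * (M : ℝ) ^ 4 ≤
        ∑ x : TorusSite 2 M, ∑ y : TorusSite 2 M, groundStateAxisCorrTorus (d := 2) M 1 1 Δ 1 x y := by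
  have hLRO := bjornbergUeltschi2022_ground_lro_spinHalf_holds 1 Δ one_pos le_rfl (by linarith)
    (by linarith)
  unfold HasEvenTorusLRO HasLongRangeOrder at hLRO
  rw [← Filter.liminf_nat_add _ 1] at hLRO
  have key : ∀ k : ℕ,
      (∑ x ∈ halfOpenBox 2 (2 * (k + 1)), ∑ y ∈ halfOpenBox 2 (2 * (k + 1)),
          torusPullback (fun L x y => groundStateAxisCorrTorus (d := 2) L 1 1 Δ 1 x y)
            (2 * (k + 1)) x y) /
        ((halfOpenBox 2 (2 * (k + 1))).card : ℝ) ^ 2 =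
      (∑ x : TorusSite 2 (2 * k + 1 + 1), ∑ y : TorusSite 2 (2 * k + 1 + 1),
          groundStateAxisCorrTorus (d := 2) (2 * k + 1 + 1) 1 1 Δ 1 x y) /
        (((2 * k + 1 + 1 : ℕ) : ℝ) ^ 2) ^ 2 := by
    intro k
    rw [show 2 * (k + 1) = 2 * k + 1 + 1 by ring, XYOrderProofs.sum_halfOpenBox_torusPullback,
      card_halfOpenBox, Nat.cast_pow]
  simp only [key] at hLRO
  have hnn : ∀ k : ℕ, 0 ≤ (∑ x : TorusSite 2 (2 * k + 1 + 1), ∑ y : TorusSite 2 (2 * k + 1 + 1),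
      groundStateAxisCorrTorus (d := 2) (2 * k + 1 + 1) 1 1 Δ 1 x y) /
        (((2 * k + 1 + 1 : ℕ) : ℝ) ^ 2) ^ 2 :=
    fun k => div_nonneg (sum_sum_groundStateAxisCorrTorus_nonneg _ 1 1 Δ 1) (by positivity)
  obtain ⟨a, ha0, hal⟩ := exists_between hLRO
  have hev := Filter.eventually_lt_of_lt_liminf hal (isBoundedUnder_of ⟨0, hnn⟩)
  obtain ⟨K₀, hK₀⟩ := Filter.eventually_atTop.1 hev
  refine ⟨a, ha0, 2 * K₀ + 2, fun M _ hMeven hM => ?_⟩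
  obtain ⟨j, hj⟩ := hMeven
  obtain ⟨k, rfl⟩ : ∃ k, M = 2 * k + 1 + 1 := ⟨j - 1, by omega⟩
  have hk : K₀ ≤ k := by omega
  have h := hK₀ k hk
  rw [lt_div_iff₀ (by positivity)] at h
  have h4 : (((2 * k + 1 + 1 : ℕ) : ℝ) ^ 2) ^ 2 = ((2 * k + 1 + 1 : ℕ) : ℝ) ^ 4 := by ring
  rw [h4] at h
  exact h.le

/-! ### The window theorem -/

/-- **Half-filled planar order on the Björnberg–Ueltschi window** (hub `HalfFilledOrder`,
`stmt-HubbardSuperconductivity-0906`, restricted to `Δ ∈ [-0.109, 0]`): for every such `Δ` there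
are `c > 0` and `M₀` such that every normalised `S³_tot = 0` sector ground state `ψ` of
`xxzHamiltonian 1 (torusGraph 2 M) (-1) Δ` on an even torus of side `M ≥ M₀` has
`c·M⁴ ≤ Re⟨ψ, S⁺_tot S⁻_tot ψ⟩`. Björnberg–Ueltschi's tracial LRO (`bu_axisFloor`) read in the frame
of `H_M(Δ)` (`re_groundStateFunctional_xx_eq_axisCorr`), uniqueness of the half-filled ground
state (`xxzTorus_groundSpace_eq_span`, `groundStateFunctional_eq_of_hasUniqueGroundState`), and
`(Sˣ)² + (Sʸ)² = S⁺S⁻` on the sector. [cite: BjornbergUeltschi2022, Theorem 3.2 and p. 11] -/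
theorem halfFilledOrder_window :
    ∀ Δ ∈ Set.Icc (-0.109 : ℝ) 0, ∃ c : ℝ, 0 < c ∧ ∃ M₀ : ℕ, ∀ (M : ℕ) [NeZero M], Even M →
      M₀ ≤ M → ∀ (ψ : TensorIndex (TorusSite 2 M) 2 → ℂ),
      ψ ∈ spinZSector (Λ := TorusSite 2 M) 1 0 → star ψ ⬝ᵥ ψ = 1 →
      Matrix.mulVec (xxzHamiltonian 1 (torusGraph 2 M) (-1) Δ) ψ =
        ((lowestEnergyInSector 1 (xxzHamiltonian 1 (torusGraph 2 M) (-1) Δ) 0 : ℝ) : ℂ) • ψ →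
      c * (M : ℝ) ^ 4 ≤ (star ψ ⬝ᵥ Matrix.mulVec
        ((∑ x : TorusSite 2 M, onSite x (spinRaise 1)) *
          (∑ y : TorusSite 2 M, onSite y (spinLower 1))) ψ).re := by
  intro Δ hΔ
  obtain ⟨a, ha, M₀, hfloor⟩ := bu_axisFloor hΔ.1 hΔ.2
  refine ⟨a, ha, max M₀ 4, fun M _ hM hMle ψ hψK hψ1 hHψ => ?_⟩
  have h4 : 4 ≤ M := le_of_max_le_right hMle
  have hM₀ : M₀ ≤ M := le_of_max_le_left hMle
  set H : Op (TorusSite 2 M) 2 := xxzHamiltonian 1 (torusGraph 2 M) (-1) Δ with hHdef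
  obtain ⟨φ, hφ0, -, hspan, hEsec⟩ := xxzTorus_groundSpace_eq_span M hM h4 hΔ.2
  -- `ψ` spans the ground space
  have hψG : ψ ∈ H.groundSpace := by
    rw [mem_groundSpace_iff, ← hEsec]; exact hHψ
  have hψ0 : ψ ≠ 0 := fun h => by
    rw [h, dotProduct_zero] at hψ1
    exact zero_ne_one hψ1
  have hU : H.HasUniqueGroundState := by
    change Module.finrank ℂ H.groundSpace = 1
    rw [hspan]
    exact finrank_span_singleton hφ0
  have hω : ∀ O : Op (TorusSite 2 M) 2, H.groundStateFunctional O = star ψ ⬝ᵥ O *ᵥ ψ := fun O => by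
    rw [groundStateFunctional_eq_of_hasUniqueGroundState hU hψG hψ0, hψ1, div_one]
  -- the floor, read as `a·M⁴ ≤ Re ω((Sˣ_tot)²)`
  have hfl := hfloor M hM hM₀
  simp only [← re_groundStateFunctional_xx_eq_axisCorr] at hfl
  rw [sum_sum_re_groundStateFunctional_siteSpin] at hfl
  -- add the nonnegative `Re ω((Sʸ_tot)²)` and pass to the vector state
  have hY : 0 ≤ (H.groundStateFunctional (totalSpin 1 1 * totalSpin 1 1)).re :=
    re_groundStateFunctional_mul_self_nonneg _ (totalSpin_isHermitian 1 1)
  have hXY : a * (M : ℝ) ^ 4 ≤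
      (H.groundStateFunctional (totalSpin 1 0 * totalSpin 1 0 + totalSpin 1 1 * totalSpin 1 1)).re := by
    rw [map_add, add_re]
    linarith
  rw [hω, ← raiseOn_mul_lowerOn_mulVec_of_mem_zero 1 hψK] at hXY
  exact hXY

/-- **What is left of `HalfFilledOrder`**: the hub statement holds as soon as it holds on the deep
easy-plane interval `Δ ∈ (-1, -0.109)` (the open part, towards the Heisenberg point `Δ = -1`);
the window `[-0.109, 0]` is `halfFilledOrder_window`. [folklore] -/
theorem halfFilledOrder_of_deepWindow
    (hdeep : ∀ Δ ∈ Set.Ioo (-1 : ℝ) (-0.109), ∃ c : ℝ, 0 < c ∧ ∃ M₀ : ℕ, ∀ (M : ℕ) [NeZero M],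
      Even M → M₀ ≤ M → ∀ (ψ : TensorIndex (TorusSite 2 M) 2 → ℂ),
      ψ ∈ spinZSector (Λ := TorusSite 2 M) 1 0 → star ψ ⬝ᵥ ψ = 1 →
      Matrix.mulVec (xxzHamiltonian 1 (torusGraph 2 M) (-1) Δ) ψ =
        ((lowestEnergyInSector 1 (xxzHamiltonian 1 (torusGraph 2 M) (-1) Δ) 0 : ℝ) : ℂ) • ψ →
      c * (M : ℝ) ^ 4 ≤ (star ψ ⬝ᵥ Matrix.mulVec
        ((∑ x : TorusSite 2 M, onSite x (spinRaise 1)) *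
          (∑ y : TorusSite 2 M, onSite y (spinLower 1))) ψ).re) :
    HalfFilledOrder := by
  intro Δ hΔ
  by_cases hw : -0.109 ≤ Δ
  · exact halfFilledOrder_window Δ ⟨hw, hΔ.2⟩
  · exact hdeep Δ ⟨hΔ.1, lt_of_not_ge hw⟩

end Summit.HubbardSuperconductivity.HubbardSuperconductivity.Theorems.LevyLogBootstrap
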